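import Summits.AtomisticToContinuum.Crystallization.Theorems.ExcessDecayLiouvilleScaleArithRoot

/-!
# Route `ExcessDecayLiouville`: scaling form of the named currencies (jump, shift, thresholds)

Harmonic-replacement architecture for item `ExcessDecay` (stmt-AtomisticToContinuum-9334), nonlinear half.
Pure real-variable inequalities bounding the named currencies of `ExcessDecayLiouvilleScaleDefs` by monomials in the
scale `ρ`, the mass constant `C`, the matching radius `r`, the crude bound `Du`, the forcing floor `Φ = phiOf Du r δ`
and the global gradient bound `N`, with every numerical constant absorbed into powers of the level constant
`L = lcOf κ ≥ 2.39·10⁸` (`1/κ ≤ L`).  This file: `jump ≤ L¹¹𝔖₁`, `ξ ≤ L¹³𝔖₁` and the three smallness thresholds of the step from `L¹³𝔖₁ ≤ κ²/10¹¹`.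
All `[folklore]`; helper lemmas, nothing here closes an item.
-/

noncomputable section

namespace Summit.AtomisticToContinuum.Crystallization.Theorems.ExcessDecayLiouville

/-- Collecting the four bracket terms of the jump bound in the root variables (pure arithmetic). [folklore] -/
theorem jump_collect {κ L σ γ r Φ Du ν : ℝ} (hκ : 0 < κ) (hL : 239000000 ≤ L) (hLκ : 239000000 / κ ≤ L) (hσ : 8 ≤ σ)
    (hγ : 0 ≤ γ) (hΦ0 : 0 ≤ Φ) (hDu : 0 ≤ Du) (hν : 0 ≤ ν) (hr0 : 0 < r) :
    239000000 / κ * (L ^ 8 * (γ * σ + σ ^ 2 * Φ + Du / (σ * r ^ 2) + σ ^ 2 * ν) +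
        L ^ 9 * (γ / σ + Φ + Du / (σ ^ 2 * r ^ 2) + σ ^ 2 * ν) +
        L ^ 8 * (γ * σ ^ 3 + σ ^ 4 * Φ + σ ^ 2 * Du / r ^ 2) / (σ ^ 2) ^ 5 +
        L ^ 7 * (γ / σ ^ 2 + Φ / σ + Du / (σ * r ^ 2)) / (σ ^ 2) ^ 2) ≤
      L ^ 11 * (γ * σ + σ ^ 2 * Φ + Du / (σ * r ^ 2) + σ ^ 2 * ν) := by
  have hσ0 : 0 < σ := by linarith
  have hσ1 : (1 : ℝ) ≤ σ := by linarith
  have hL0 : 0 ≤ L := le_trans (by norm_num) hL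
  have hL1 : 1 ≤ L := le_trans (by norm_num) hL
  set S : ℝ := γ * σ + σ ^ 2 * Φ + Du / (σ * r ^ 2) + σ ^ 2 * ν with hS
  have hm1 : 0 ≤ γ * σ := by positivity
  have hm2 : 0 ≤ σ ^ 2 * Φ := by positivity
  have hm3 : 0 ≤ Du / (σ * r ^ 2) := by positivity
  have hm4 : 0 ≤ σ ^ 2 * ν := by positivity
  have hS0 : 0 ≤ S := by rw [hS]; positivity
  -- elementary comparisons (σ ≥ 1)
  have c1 : γ / σ ≤ γ * σ := (div_le_self hγ hσ1).trans (le_mul_of_one_le_right hγ hσ1)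
  have c2 : Φ ≤ σ ^ 2 * Φ := le_mul_of_one_le_left hΦ0 (one_le_pow₀ hσ1)
  have c3 : Du / (σ ^ 2 * r ^ 2) ≤ Du / (σ * r ^ 2) := by
    refine div_le_div_of_nonneg_left hDu (by positivity) ?_
    have : σ ≤ σ ^ 2 := by nlinarith
    nlinarith [this, pow_pos hr0 2]
  have hs2 : γ / σ + Φ + Du / (σ ^ 2 * r ^ 2) + σ ^ 2 * ν ≤ S := by rw [hS]; linarith
  have hv : L ^ 8 * (γ * σ ^ 3 + σ ^ 4 * Φ + σ ^ 2 * Du / r ^ 2) / (σ ^ 2) ^ 5 ≤ L ^ 8 * S := by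
    have e : L ^ 8 * (γ * σ ^ 3 + σ ^ 4 * Φ + σ ^ 2 * Du / r ^ 2) / (σ ^ 2) ^ 5 =
        L ^ 8 * ((γ * σ) / σ ^ 8 + (σ ^ 2 * Φ) / σ ^ 8 + (Du / (σ * r ^ 2)) / σ ^ 7) := by
      field_simp
    rw [e]
    refine mul_le_mul_of_nonneg_left ?_ (pow_nonneg hL0 8)
    have d1 : (γ * σ) / σ ^ 8 ≤ γ * σ := div_le_self hm1 (one_le_pow₀ hσ1)
    have d2 : (σ ^ 2 * Φ) / σ ^ 8 ≤ σ ^ 2 * Φ := div_le_self hm2 (one_le_pow₀ hσ1)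
    have d3 : (Du / (σ * r ^ 2)) / σ ^ 7 ≤ Du / (σ * r ^ 2) := div_le_self hm3 (one_le_pow₀ hσ1)
    rw [hS]; linarith
  have hsJ : L ^ 7 * (γ / σ ^ 2 + Φ / σ + Du / (σ * r ^ 2)) / (σ ^ 2) ^ 2 ≤ L ^ 7 * S := by
    have e : L ^ 7 * (γ / σ ^ 2 + Φ / σ + Du / (σ * r ^ 2)) / (σ ^ 2) ^ 2 =
        L ^ 7 * ((γ * σ) / σ ^ 7 + (σ ^ 2 * Φ) / σ ^ 7 + (Du / (σ * r ^ 2)) / σ ^ 4) := by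
      field_simp
    rw [e]
    refine mul_le_mul_of_nonneg_left ?_ (pow_nonneg hL0 7)
    have d1 : (γ * σ) / σ ^ 7 ≤ γ * σ := div_le_self hm1 (one_le_pow₀ hσ1)
    have d2 : (σ ^ 2 * Φ) / σ ^ 7 ≤ σ ^ 2 * Φ := div_le_self hm2 (one_le_pow₀ hσ1)
    have d3 : (Du / (σ * r ^ 2)) / σ ^ 4 ≤ Du / (σ * r ^ 2) := div_le_self hm3 (one_le_pow₀ hσ1)
    rw [hS]; linarith
  have hs2' := mul_le_mul_of_nonneg_left hs2 (pow_nonneg hL0 9)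
  have hL7 : L ^ 7 ≤ L ^ 8 := pow_le_pow_right₀ hL1 (by norm_num)
  have hL8 : 3 * L ^ 8 ≤ L ^ 9 := by
    rw [show L ^ 9 = L ^ 8 * L by ring]; nlinarith only [pow_nonneg hL0 8, hL]
  have hbr : L ^ 8 * S + L ^ 9 * (γ / σ + Φ + Du / (σ ^ 2 * r ^ 2) + σ ^ 2 * ν) +
      L ^ 8 * (γ * σ ^ 3 + σ ^ 4 * Φ + σ ^ 2 * Du / r ^ 2) / (σ ^ 2) ^ 5 +
      L ^ 7 * (γ / σ ^ 2 + Φ / σ + Du / (σ * r ^ 2)) / (σ ^ 2) ^ 2 ≤ 2 * L ^ 9 * S := by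
    nlinarith only [hs2', hv, hsJ, mul_le_mul_of_nonneg_right hL7 hS0, mul_le_mul_of_nonneg_right hL8 hS0, hS0]
  have hL9 : 2 * L ^ 10 ≤ L ^ 11 := by
    rw [show L ^ 11 = L ^ 10 * L by ring]; nlinarith only [pow_nonneg hL0 10, hL]
  have hk0 : 0 ≤ 239000000 / κ := by positivity
  have h2S : 0 ≤ 2 * L ^ 9 * S := by positivity
  calc 239000000 / κ * (L ^ 8 * S + L ^ 9 * (γ / σ + Φ + Du / (σ ^ 2 * r ^ 2) + σ ^ 2 * ν) +
        L ^ 8 * (γ * σ ^ 3 + σ ^ 4 * Φ + σ ^ 2 * Du / r ^ 2) / (σ ^ 2) ^ 5 +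
        L ^ 7 * (γ / σ ^ 2 + Φ / σ + Du / (σ * r ^ 2)) / (σ ^ 2) ^ 2)
      ≤ 239000000 / κ * (2 * L ^ 9 * S) := mul_le_mul_of_nonneg_left hbr hk0
    _ ≤ L * (2 * L ^ 9 * S) := mul_le_mul_of_nonneg_right hLκ h2S
    _ = 2 * L ^ 10 * S := by ring
    _ ≤ L ^ 11 * S := mul_le_mul_of_nonneg_right hL9 hS0

/-- **The optical jump in the root variables**: `jump ≤ L¹¹ 𝔖₁`, `𝔖₁ = γσ + σ²Φ + Du/(σr²) + σ²ν`. [folklore] -/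
theorem jump_le_root {κ σ γ r δ Du j b ν : ℝ} (hκ : 0 < κ) (hκ1 : κ ≤ 1) (hσ : 8 ≤ σ) (hσr : σ ^ 2 ≤ r)
    (hγ : 0 ≤ γ) (hr : 1 ≤ r) (hδ : 0 < δ) (hDu : 0 ≤ Du) (hj : 0 ≤ j) (hb : 0 ≤ b) (hΛ1 : lamOf Du j b ≤ 1)
    (hν : 0 ≤ ν) :
    jumpOf κ (σ ^ 2) (thetaOneOf κ (σ ^ 2) (γ ^ 2) r δ Du Du j b (ν ^ 2 * r ^ 7))
        (thetaTwoOf κ (σ ^ 2) (γ ^ 2) r δ Du Du j b (ν ^ 2 * r ^ 7))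
        (Real.sqrt (vsqOf κ (σ ^ 2) (γ ^ 2) r δ Du Du j b)) (jhOf κ (σ ^ 2) (γ ^ 2) r δ Du Du j b) ≤
      lcOf κ ^ 11 * (γ * σ + σ ^ 2 * phiOf Du r δ + Du / (σ * r ^ 2) + σ ^ 2 * ν) := by
  have hr0 : 0 < r := by linarith
  obtain ⟨hL, -, hLκ'⟩ := lcOf_ge hκ hκ1
  have hΦ0 := phiOf_nonneg hDu hr0 hδ
  have h1 := sqrt_thetaOne_le (δ := δ) (ν := ν) hκ hκ1 hσ hσr hγ hr hδ hDu hj hb hΛ1 hν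
  have h2 := sqrt_thetaTwo_le (δ := δ) (ν := ν) hκ hκ1 hσ hσr hγ hr hδ hDu hj hb hΛ1 hν
  have hV := sqrt_vsq_le (δ := δ) hκ hκ1 hσ hσr hγ hr hδ hDu hj hb hΛ1
  have hJ := sqrt_jh_le (δ := δ) hκ hκ1 hσ hσr hγ hr hδ hDu hj hb hΛ1
  have hmain := jumpOf_le_aux hκ (by nlinarith : (64 : ℝ) ≤ σ ^ 2) h1 h2 (Real.sqrt_nonneg _) hV hJ
  exact hmain.trans (jump_collect hκ hL hLκ' hσ hγ hΦ0 hDu hν hr0)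

/-- The two Lipschitz constants against a level: `(4/κ)(Cˢ L¹¹ S + Cᴮ·12 L⁸ S) ≤ L¹³ S`. [folklore] -/
theorem lipschitz_collect {κ L S : ℝ} (hL : 239000000 ≤ L) (hLκ : 1 / κ ≤ L) (hS : 0 ≤ S) :
    4 / κ * (4600000 * (L ^ 11 * S) + 9600000 * (12 * (L ^ 8 * S))) ≤ L ^ 13 * S := by
  have hL0 : 0 ≤ L := le_trans (by norm_num) hL
  have hk : 4 / κ ≤ 4 * L := by
    rw [div_eq_mul_one_div]; exact mul_le_mul_of_nonneg_left hLκ (by norm_num)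
  have hL3 : (230400000 : ℝ) ≤ L ^ 3 := by
    have := pow_le_pow_left₀ (by norm_num : (0 : ℝ) ≤ 239000000) hL 3
    exact le_trans (by norm_num) this
  have h8 : 9600000 * (12 * L ^ 8) ≤ 10000 * L ^ 11 := by
    rw [show L ^ 11 = L ^ 8 * L ^ 3 by ring]; nlinarith only [pow_nonneg hL0 8, hL3]
  have hc : 4 * L * (4600000 * L ^ 11 + 9600000 * (12 * L ^ 8)) ≤ L ^ 13 := by
    have h12 : 18440000 * L ^ 12 ≤ L ^ 13 := by
      rw [show L ^ 13 = L ^ 12 * L by ring]; nlinarith only [pow_nonneg hL0 12, hL]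
    have e : 4 * L * (4600000 * L ^ 11 + 10000 * L ^ 11) = 18440000 * L ^ 12 := by ring
    nlinarith only [h8, h12, e, hL0]
  calc 4 / κ * (4600000 * (L ^ 11 * S) + 9600000 * (12 * (L ^ 8 * S)))
      = 4 / κ * ((4600000 * L ^ 11 + 9600000 * (12 * L ^ 8)) * S) := by ring
    _ ≤ 4 * L * ((4600000 * L ^ 11 + 9600000 * (12 * L ^ 8)) * S) := mul_le_mul_of_nonneg_right hk (by positivity)
    _ = (4 * L * (4600000 * L ^ 11 + 9600000 * (12 * L ^ 8))) * S := by ring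
    _ ≤ L ^ 13 * S := mul_le_mul_of_nonneg_right hc hS

/-- **The relaxation shift in the root variables**: `ξ ≤ L¹³ 𝔖₁`. [folklore] -/
theorem xi_le_root {κ σ γ r δ Du j b ν : ℝ} (hκ : 0 < κ) (hκ1 : κ ≤ 1) (hσ : 8 ≤ σ) (hσr : σ ^ 2 ≤ r)
    (hγ : 0 ≤ γ) (hr : 1 ≤ r) (hδ : 0 < δ) (hDu : 0 ≤ Du) (hj : 0 ≤ j) (hb : 0 ≤ b) (hΛ1 : lamOf Du j b ≤ 1)
    (hν : 0 ≤ ν) :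
    xiOf κ (σ ^ 2) (thetaOneOf κ (σ ^ 2) (γ ^ 2) r δ Du Du j b (ν ^ 2 * r ^ 7))
        (thetaTwoOf κ (σ ^ 2) (γ ^ 2) r δ Du Du j b (ν ^ 2 * r ^ 7))
        (Real.sqrt (vsqOf κ (σ ^ 2) (γ ^ 2) r δ Du Du j b)) (jhOf κ (σ ^ 2) (γ ^ 2) r δ Du Du j b) ≤
      lcOf κ ^ 13 * (γ * σ + σ ^ 2 * phiOf Du r δ + Du / (σ * r ^ 2) + σ ^ 2 * ν) := by
  have hσ0 : 0 < σ := by linarith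
  have hr0 : 0 < r := by linarith
  obtain ⟨hL, hLκ, -⟩ := lcOf_ge hκ hκ1
  have hL0 : 0 ≤ lcOf κ := le_trans (by norm_num) hL
  have hΦ0 := phiOf_nonneg hDu hr0 hδ
  obtain ⟨hcs, hcb, hcs0, hcb0⟩ := csLip_cbLip_le
  have hS0 : 0 ≤ γ * σ + σ ^ 2 * phiOf Du r δ + Du / (σ * r ^ 2) + σ ^ 2 * ν := by positivity
  have hjump := jump_le_root (δ := δ) (ν := ν) hκ hκ1 hσ hσr hγ hr hδ hDu hj hb hΛ1 hν
  have h1 := sqrt_thetaOne_le (δ := δ) (ν := ν) hκ hκ1 hσ hσr hγ hr hδ hDu hj hb hΛ1 hν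
  have hj0 := jumpOf_nonneg (Θ₁ := thetaOneOf κ (σ ^ 2) (γ ^ 2) r δ Du Du j b (ν ^ 2 * r ^ 7))
    (Θ₂ := thetaTwoOf κ (σ ^ 2) (γ ^ 2) r δ Du Du j b (ν ^ 2 * r ^ 7)) (J := jhOf κ (σ ^ 2) (γ ^ 2) r δ Du Du j b)
    hκ (by nlinarith : (64 : ℝ) ≤ σ ^ 2) (Real.sqrt_nonneg (vsqOf κ (σ ^ 2) (γ ^ 2) r δ Du Du j b))
  have i1 := mul_le_mul hcs hjump hj0 (by norm_num)
  have i2 : cbLip * (12 * Real.sqrt (thetaOneOf κ (σ ^ 2) (γ ^ 2) r δ Du Du j b (ν ^ 2 * r ^ 7))) ≤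
      9600000 * (12 * (lcOf κ ^ 8 * (γ * σ + σ ^ 2 * phiOf Du r δ + Du / (σ * r ^ 2) + σ ^ 2 * ν))) :=
    mul_le_mul hcb (by linarith) (by positivity) (by norm_num)
  unfold xiOf
  calc _ ≤ 4 / κ * (4600000 * (lcOf κ ^ 11 * (γ * σ + σ ^ 2 * phiOf Du r δ + Du / (σ * r ^ 2) + σ ^ 2 * ν)) +
        9600000 * (12 * (lcOf κ ^ 8 * (γ * σ + σ ^ 2 * phiOf Du r δ + Du / (σ * r ^ 2) + σ ^ 2 * ν)))) := by
        refine mul_le_mul_of_nonneg_left ?_ (by positivity); linarith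
    _ ≤ _ := lipschitz_collect hL hLκ hS0

/-- **One smallness condition gives the three thresholds of the step**: if `L¹³ 𝔖₁ ≤ κ²/10¹¹` then
`12√Θ₁ ≤ κ/(2·10¹⁰)`, `jump ≤ κ/(2·10¹⁰)` and `Cˢ·jump + Cᴮ·12√Θ₁ ≤ κ²/10¹¹`. [folklore] -/
theorem step_thresholds {κ σ γ r δ Du j b ν : ℝ} (hκ : 0 < κ) (hκ1 : κ ≤ 1) (hσ : 8 ≤ σ) (hσr : σ ^ 2 ≤ r)
    (hγ : 0 ≤ γ) (hr : 1 ≤ r) (hδ : 0 < δ) (hDu : 0 ≤ Du) (hj : 0 ≤ j) (hb : 0 ≤ b) (hΛ1 : lamOf Du j b ≤ 1)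
    (hν : 0 ≤ ν)
    (hsmall : lcOf κ ^ 13 * (γ * σ + σ ^ 2 * phiOf Du r δ + Du / (σ * r ^ 2) + σ ^ 2 * ν) ≤ κ ^ 2 / 10 ^ 11) :
    12 * Real.sqrt (thetaOneOf κ (σ ^ 2) (γ ^ 2) r δ Du Du j b (ν ^ 2 * r ^ 7)) ≤ κ / (2 * 10 ^ 10) ∧
    jumpOf κ (σ ^ 2) (thetaOneOf κ (σ ^ 2) (γ ^ 2) r δ Du Du j b (ν ^ 2 * r ^ 7))
        (thetaTwoOf κ (σ ^ 2) (γ ^ 2) r δ Du Du j b (ν ^ 2 * r ^ 7))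
        (Real.sqrt (vsqOf κ (σ ^ 2) (γ ^ 2) r δ Du Du j b)) (jhOf κ (σ ^ 2) (γ ^ 2) r δ Du Du j b) ≤ κ / (2 * 10 ^ 10) ∧
    csLip * jumpOf κ (σ ^ 2) (thetaOneOf κ (σ ^ 2) (γ ^ 2) r δ Du Du j b (ν ^ 2 * r ^ 7))
        (thetaTwoOf κ (σ ^ 2) (γ ^ 2) r δ Du Du j b (ν ^ 2 * r ^ 7))
        (Real.sqrt (vsqOf κ (σ ^ 2) (γ ^ 2) r δ Du Du j b)) (jhOf κ (σ ^ 2) (γ ^ 2) r δ Du Du j b) +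
      cbLip * (12 * Real.sqrt (thetaOneOf κ (σ ^ 2) (γ ^ 2) r δ Du Du j b (ν ^ 2 * r ^ 7))) ≤ κ ^ 2 / 10 ^ 11 := by
  have hσ0 : 0 < σ := by linarith
  have hr0 : 0 < r := by linarith
  obtain ⟨hL, hLκ, -⟩ := lcOf_ge hκ hκ1
  have hL0 : 0 ≤ lcOf κ := le_trans (by norm_num) hL
  have hL1 : 1 ≤ lcOf κ := le_trans (by norm_num) hL
  have hΦ0 := phiOf_nonneg hDu hr0 hδ
  obtain ⟨hcs, hcb, hcs0, hcb0⟩ := csLip_cbLip_le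
  set L := lcOf κ with hLdef
  set S : ℝ := γ * σ + σ ^ 2 * phiOf Du r δ + Du / (σ * r ^ 2) + σ ^ 2 * ν with hS
  have hS0 : 0 ≤ S := by positivity
  have hjump := jump_le_root (δ := δ) (ν := ν) hκ hκ1 hσ hσr hγ hr hδ hDu hj hb hΛ1 hν
  have h1 := sqrt_thetaOne_le (δ := δ) (ν := ν) hκ hκ1 hσ hσr hγ hr hδ hDu hj hb hΛ1 hν
  have hj0 := jumpOf_nonneg (Θ₁ := thetaOneOf κ (σ ^ 2) (γ ^ 2) r δ Du Du j b (ν ^ 2 * r ^ 7))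
    (Θ₂ := thetaTwoOf κ (σ ^ 2) (γ ^ 2) r δ Du Du j b (ν ^ 2 * r ^ 7)) (J := jhOf κ (σ ^ 2) (γ ^ 2) r δ Du Du j b)
    hκ (by nlinarith : (64 : ℝ) ≤ σ ^ 2) (Real.sqrt_nonneg (vsqOf κ (σ ^ 2) (γ ^ 2) r δ Du Du j b))
  -- κ²/10¹¹ ≤ κ/(2·10¹⁰)
  have hκκ : κ ^ 2 / 10 ^ 11 ≤ κ / (2 * 10 ^ 10) := by
    rw [div_le_div_iff₀ (by positivity) (by positivity)]; nlinarith
  -- level comparisons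
  have h12 : 12 * (L ^ 8 * S) ≤ L ^ 13 * S := by
    have h4 : (12 : ℝ) ≤ L ^ 5 := le_trans (by linarith : (12 : ℝ) ≤ L) (le_self_pow₀ hL1 (by norm_num))
    have : 12 * L ^ 8 ≤ L ^ 13 := by
      rw [show L ^ 13 = L ^ 8 * L ^ 5 by ring]; nlinarith only [pow_nonneg hL0 8, h4]
    nlinarith only [this, hS0]
  have h11 : L ^ 11 * S ≤ L ^ 13 * S := mul_le_mul_of_nonneg_right (pow_le_pow_right₀ hL1 (by norm_num)) hS0
  refine ⟨?_, ?_, ?_⟩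
  · calc 12 * Real.sqrt _ ≤ 12 * (L ^ 8 * S) := by linarith
      _ ≤ L ^ 13 * S := h12
      _ ≤ κ ^ 2 / 10 ^ 11 := hsmall
      _ ≤ κ / (2 * 10 ^ 10) := hκκ
  · exact hjump.trans (h11.trans (hsmall.trans hκκ))
  · have i1 := mul_le_mul hcs hjump hj0 (by norm_num)
    have i2 : cbLip * (12 * Real.sqrt (thetaOneOf κ (σ ^ 2) (γ ^ 2) r δ Du Du j b (ν ^ 2 * r ^ 7))) ≤
        9600000 * (12 * (L ^ 8 * S)) :=
      mul_le_mul hcb (by linarith) (by positivity) (by norm_num)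
    have hk1 : (1 : ℝ) ≤ 4 / κ := by rw [le_div_iff₀ hκ]; linarith
    have hsum0 : 0 ≤ 4600000 * (L ^ 11 * S) + 9600000 * (12 * (L ^ 8 * S)) := by positivity
    have hc : 4600000 * (L ^ 11 * S) + 9600000 * (12 * (L ^ 8 * S)) ≤ L ^ 13 * S :=
      (le_mul_of_one_le_left hsum0 hk1).trans (lipschitz_collect hL hLκ hS0)
    linarith [i1, i2, hc, hsmall]

end Summit.AtomisticToContinuum.Crystallization.Theorems.ExcessDecayLiouville

end
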